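import Summits.AnomalousDissipation.AnomalousDissipation.Theorems.TaylorCertificatesKolmogorovFloorResponseDefs

/-!
# ASSEMBLY of line `Sketch` (digit-frame-closure), part 1: lattice and triad algebra
(crux stmt-AnomalousDissipation-15122, negative side of `TaylorCertificates.KolmogorovFloor`; line lead)

Pure algebra linking the closed-form LINE sequences of `TaylorCertificatesKolmogorovFloorResponseDefs` to the
LATTICE coefficient function `respCoeff`: the integer triad decomposition `e2 X2 k = (k·e) X2 e + (k·ξ) e2 ξ + (k·n) n`
(`n = ξ × e`, `ξ ⊥ e`) and its complex form, the bilinear pairing `ipair` against the triad, the frequency of a line site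
`k + mξ` and its squared norm `N_m`, injectivity of `(k, m) ↦ k + mξ` on small `k`, and the behaviour of `lineData`,
`lineForce`, `lineCoeff` under `(k, v) ↦ (−k, conj v)`.
-/

noncomputable section

set_option linter.dupNamespace false

open Matrix Finset UnitAddTorus
open scoped BigOperators ComplexConjugate

namespace Summit.AnomalousDissipation.AnomalousDissipation.Theorems.KolmogorovFloor.Response

open Literature.Analysis.FunctionSpaces Literature.Analysis.FluidPDE

/-! ### The integer triad -/

/-- Dot products on `Fin 3`, written out. -/
theorem dotProduct_fin3 (a b : Fin 3 → ℤ) : a ⬝ᵥ b = a 0 * b 0 + a 1 * b 1 + a 2 * b 2 := by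
  simp [dotProduct, Fin.sum_univ_three]

/-- **Triad decomposition** (integer form): for `ξ ⊥ e` and `n = ξ × e`, every lattice vector `k` satisfies
`(e·e)(ξ·ξ) k = ((k·e)(ξ·ξ)) e + ((k·ξ)(e·e)) ξ + (k·n) n`. -/
theorem triad_decomp {ξ e : Fin 3 → ℤ} (h : ξ ⬝ᵥ e = 0) (k : Fin 3 → ℤ) :
    ((e ⬝ᵥ e) * (ξ ⬝ᵥ ξ)) • k =
      ((k ⬝ᵥ e) * (ξ ⬝ᵥ ξ)) • e + ((k ⬝ᵥ ξ) * (e ⬝ᵥ e)) • ξ + (k ⬝ᵥ cross3 ξ e) • cross3 ξ e := by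
  rw [dotProduct_fin3] at h
  ext i
  fin_cases i
  · simp [cross3, dotProduct_fin3, Matrix.vecHead, Matrix.vecTail, Fin.succ_zero_eq_one, Fin.succ_one_eq_two]
    linear_combination ((ξ 0 * e 0 + ξ 1 * e 1 + ξ 2 * e 2) * k 0 - (k 0 * e 0 + k 1 * e 1 + k 2 * e 2) * ξ 0
      - (k 0 * ξ 0 + k 1 * ξ 1 + k 2 * ξ 2) * e 0) * h
  · simp [cross3, dotProduct_fin3, Matrix.vecHead, Matrix.vecTail, Fin.succ_zero_eq_one, Fin.succ_one_eq_two]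
    linear_combination ((ξ 0 * e 0 + ξ 1 * e 1 + ξ 2 * e 2) * k 1 - (k 0 * e 0 + k 1 * e 1 + k 2 * e 2) * ξ 1
      - (k 0 * ξ 0 + k 1 * ξ 1 + k 2 * ξ 2) * e 1) * h
  · simp [cross3, dotProduct_fin3, Matrix.vecHead, Matrix.vecTail, Fin.succ_zero_eq_one, Fin.succ_one_eq_two]
    linear_combination ((ξ 0 * e 0 + ξ 1 * e 1 + ξ 2 * e 2) * k 2 - (k 0 * e 0 + k 1 * e 1 + k 2 * e 2) * ξ 2
      - (k 0 * ξ 0 + k 1 * ξ 1 + k 2 * ξ 2) * e 2) * h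

/-- Complex form of the triad decomposition: for `ξ ⊥ e`, `n = ξ × e` and every `v ∈ ℂ³`,
`(e·e)(ξ·ξ) v = (e·v)(ξ·ξ) e + (ξ·v)(e·e) ξ + (n·v) n` (bilinear pairings, no conjugation). -/
theorem triad_decomp_complex {ξ e : Fin 3 → ℤ} (h : ξ ⬝ᵥ e = 0) (v : EuclideanSpace ℂ (Fin 3)) :
    (((e ⬝ᵥ e) * (ξ ⬝ᵥ ξ) : ℤ) : ℂ) • v =
      (ipair e v * ((ξ ⬝ᵥ ξ : ℤ) : ℂ)) • Torus.freqVec e + (ipair ξ v * ((e ⬝ᵥ e : ℤ) : ℂ)) • Torus.freqVec ξ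
        + ipair (cross3 ξ e) v • Torus.freqVec (cross3 ξ e) := by
  rw [dotProduct_fin3] at h
  have hC : (ξ 0 : ℂ) * e 0 + ξ 1 * e 1 + ξ 2 * e 2 = 0 := by exact_mod_cast h
  ext i
  fin_cases i
  · simp [cross3, dotProduct_fin3, ipair, Fin.sum_univ_three]
    linear_combination (((ξ 0 : ℂ) * e 0 + ξ 1 * e 1 + ξ 2 * e 2) * v 0
      - ((e 0 : ℂ) * v 0 + e 1 * v 1 + e 2 * v 2) * ξ 0 - ((ξ 0 : ℂ) * v 0 + ξ 1 * v 1 + ξ 2 * v 2) * e 0) * hC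
  · simp [cross3, dotProduct_fin3, ipair, Fin.sum_univ_three]
    linear_combination (((ξ 0 : ℂ) * e 0 + ξ 1 * e 1 + ξ 2 * e 2) * v 1
      - ((e 0 : ℂ) * v 0 + e 1 * v 1 + e 2 * v 2) * ξ 1 - ((ξ 0 : ℂ) * v 0 + ξ 1 * v 1 + ξ 2 * v 2) * e 1) * hC
  · simp [cross3, dotProduct_fin3, ipair, Fin.sum_univ_three]
    linear_combination (((ξ 0 : ℂ) * e 0 + ξ 1 * e 1 + ξ 2 * e 2) * v 2
      - ((e 0 : ℂ) * v 0 + e 1 * v 1 + e 2 * v 2) * ξ 2 - ((ξ 0 : ℂ) * v 0 + ξ 1 * v 1 + ξ 2 * v 2) * e 2) * hC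

/-! ### The bilinear pairing `ipair` and the frequency vector -/

/-- `ipair` is additive in the complex argument. -/
theorem ipair_add (w : Fin 3 → ℤ) (u v : EuclideanSpace ℂ (Fin 3)) : ipair w (u + v) = ipair w u + ipair w v := by
  simp only [ipair, PiLp.add_apply, mul_add, Finset.sum_add_distrib]

/-- `ipair` is homogeneous in the complex argument. -/
theorem ipair_smul (w : Fin 3 → ℤ) (x : ℂ) (v : EuclideanSpace ℂ (Fin 3)) : ipair w (x • v) = x * ipair w v := by
  simp only [ipair, PiLp.smul_apply, smul_eq_mul, Finset.mul_sum]
  exact Finset.sum_congr rfl fun i _ => by ring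

/-- `ipair` of the zero vector. -/
@[simp] theorem ipair_zero (w : Fin 3 → ℤ) : ipair w (0 : EuclideanSpace ℂ (Fin 3)) = 0 := by
  simp [ipair]

/-- `ipair` respects subtraction in the complex argument. -/
theorem ipair_sub (w : Fin 3 → ℤ) (u v : EuclideanSpace ℂ (Fin 3)) : ipair w (u - v) = ipair w u - ipair w v := by
  simp only [ipair, PiLp.sub_apply, mul_sub, Finset.sum_sub_distrib]

/-- `ipair` commutes with finite sums in the complex argument. -/
theorem ipair_sum {ι : Type*} (s : Finset ι) (w : Fin 3 → ℤ) (v : ι → EuclideanSpace ℂ (Fin 3)) :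
    ipair w (∑ i ∈ s, v i) = ∑ i ∈ s, ipair w (v i) := by
  classical
  induction s using Finset.induction_on with
  | empty => simp
  | insert a s ha ih => rw [Finset.sum_insert ha, Finset.sum_insert ha, ipair_add, ih]

/-- `ipair` against a conditional vector. -/
theorem ipair_ite (w : Fin 3 → ℤ) (P : Prop) [Decidable P] (v : EuclideanSpace ℂ (Fin 3)) :
    ipair w (if P then v else 0) = if P then ipair w v else 0 := by
  split_ifs <;> simp

/-- `ipair` of two integer vectors is their dot product: `ipair w (freqVec u) = w · u`. -/
theorem ipair_freqVec (w u : Fin 3 → ℤ) : ipair w (Torus.freqVec u) = ((w ⬝ᵥ u : ℤ) : ℂ) := by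
  simp [ipair, dotProduct_fin3, Fin.sum_univ_three, Torus.freqVec_apply]

/-- `ipair w v = ⟪freqVec w, v⟫_ℂ` (the frequency vector is real). -/
theorem ipair_eq_inner (w : Fin 3 → ℤ) (v : EuclideanSpace ℂ (Fin 3)) :
    ipair w v = inner ℂ (Torus.freqVec w) v := by
  rw [Torus.inner_freqVec_left]; rfl

/-- `ipair` commutes with complex conjugation of the complex argument (the integer vector is real). -/
theorem ipair_conjVec (w : Fin 3 → ℤ) (v : EuclideanSpace ℂ (Fin 3)) :
    ipair w (EuclideanSpace.conjVec v) = starRingEnd ℂ (ipair w v) := by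
  simp [ipair, map_sum, map_mul, EuclideanSpace.conjVec_apply]

/-- `‖freqVec w‖² = w · w`. -/
theorem norm_freqVec_sq (w : Fin 3 → ℤ) : ‖Torus.freqVec w‖ ^ 2 = ((w ⬝ᵥ w : ℤ) : ℝ) := by
  rw [EuclideanSpace.norm_sq_eq]
  simp [dotProduct_fin3, Fin.sum_univ_three, Torus.freqVec_apply, Complex.norm_intCast, sq_abs]
  ring

/-- `‖freqVec w‖ = √(w · w)`. -/
theorem norm_freqVec (w : Fin 3 → ℤ) : ‖Torus.freqVec w‖ = Real.sqrt ((w ⬝ᵥ w : ℤ) : ℝ) := by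
  rw [← norm_freqVec_sq, Real.sqrt_sq (norm_nonneg _)]

/-- Cauchy–Schwarz for `ipair`: `‖w · v‖ ≤ √(w·w) ‖v‖`. -/
theorem norm_ipair_le (w : Fin 3 → ℤ) (v : EuclideanSpace ℂ (Fin 3)) :
    ‖ipair w v‖ ≤ Real.sqrt ((w ⬝ᵥ w : ℤ) : ℝ) * ‖v‖ := by
  rw [ipair_eq_inner, ← norm_freqVec]
  exact norm_inner_le_norm _ _

/-- The frequency vector is additive. -/
theorem freqVec_add (k l : Fin 3 → ℤ) : Torus.freqVec (k + l) = Torus.freqVec k + Torus.freqVec l := by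
  ext i; simp [Torus.freqVec_apply]

/-- The frequency vector of a line site: `freqVec (k + mξ) = freqVec k + m • freqVec ξ`
(the scaling half is `MomentParityCubicParityLoud.freqVec_smul`, inlined here to keep the import cone small). -/
theorem freqVec_lineSite (k ξ : Fin 3 → ℤ) (m : ℤ) :
    Torus.freqVec (k + m • ξ) = Torus.freqVec k + (m : ℂ) • Torus.freqVec ξ := by
  ext i; simp [Torus.freqVec_apply]

/-! ### Line sites `k + mξ` -/

/-- The fields of `lineData`. -/
@[simp] theorem lineData_a (k ξ e : Fin 3 → ℤ) : (lineData k ξ e).a = k ⬝ᵥ e := rfl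
/-- The fields of `lineData`. -/
@[simp] theorem lineData_c (k ξ e : Fin 3 → ℤ) : (lineData k ξ e).c = k ⬝ᵥ cross3 ξ e := rfl
/-- The fields of `lineData`. -/
@[simp] theorem lineData_s (k ξ e : Fin 3 → ℤ) : (lineData k ξ e).s = k ⬝ᵥ ξ := rfl
/-- The fields of `lineData`. -/
@[simp] theorem lineData_K (k ξ e : Fin 3 → ℤ) : (lineData k ξ e).K = k ⬝ᵥ k := rfl
/-- The fields of `lineData`. -/
@[simp] theorem lineData_X2 (k ξ e : Fin 3 → ℤ) : (lineData k ξ e).X2 = ξ ⬝ᵥ ξ := rfl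
/-- The fields of `lineData`. -/
@[simp] theorem lineData_e2 (k ξ e : Fin 3 → ℤ) : (lineData k ξ e).e2 = e ⬝ᵥ e := rfl
/-- The fields of `lineData`. -/
@[simp] theorem lineData_n2 (k ξ e : Fin 3 → ℤ) : (lineData k ξ e).n2 = cross3 ξ e ⬝ᵥ cross3 ξ e := rfl
/-- The fields of `lineForce`. -/
@[simp] theorem lineForce_ve (ξ e : Fin 3 → ℤ) (v : EuclideanSpace ℂ (Fin 3)) :
    (lineForce ξ e v).ve = ipair e v / ((e ⬝ᵥ e : ℤ) : ℂ) := rfl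
/-- The fields of `lineForce`. -/
@[simp] theorem lineForce_vx (ξ e : Fin 3 → ℤ) (v : EuclideanSpace ℂ (Fin 3)) :
    (lineForce ξ e v).vx = ipair ξ v / ((ξ ⬝ᵥ ξ : ℤ) : ℂ) := rfl
/-- The fields of `lineForce`. -/
@[simp] theorem lineForce_vn (ξ e : Fin 3 → ℤ) (v : EuclideanSpace ℂ (Fin 3)) :
    (lineForce ξ e v).vn = ipair (cross3 ξ e) v / ((cross3 ξ e ⬝ᵥ cross3 ξ e : ℤ) : ℂ) := rfl

/-- A line site is orthogonal-projected onto `e` exactly like its base mode: `(k + mξ)·e = k·e` (`ξ ⊥ e`). -/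
theorem lineSite_dot_e {ξ e : Fin 3 → ℤ} (h : ξ ⬝ᵥ e = 0) (k : Fin 3 → ℤ) (m : ℤ) :
    (k + m • ξ) ⬝ᵥ e = k ⬝ᵥ e := by
  rw [add_dotProduct, smul_dotProduct, h, smul_zero, add_zero]

/-- `(k + mξ)·ξ = k·ξ + m ξ·ξ = T_m`. -/
theorem lineSite_dot_xi (ξ e k : Fin 3 → ℤ) (m : ℤ) :
    (k + m • ξ) ⬝ᵥ ξ = (lineData k ξ e).T m := by
  rw [add_dotProduct, smul_dotProduct, smul_eq_mul]; rfl

/-- `(k + mξ)·n = k·n` for `n = ξ × e`. -/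
theorem lineSite_dot_n (ξ e k : Fin 3 → ℤ) (m : ℤ) :
    (k + m • ξ) ⬝ᵥ cross3 ξ e = k ⬝ᵥ cross3 ξ e := by
  rw [add_dotProduct, smul_dotProduct, dotProduct_comm ξ, cross3_dotProduct_left, smul_zero, add_zero]

/-- The squared norm of a line site is `N_m = K + 2ms + m² X2`. -/
theorem lineSite_dot_self (ξ e k : Fin 3 → ℤ) (m : ℤ) :
    (k + m • ξ) ⬝ᵥ (k + m • ξ) = (lineData k ξ e).N m := by
  simp only [add_dotProduct, dotProduct_add, smul_dotProduct, dotProduct_smul, smul_eq_mul, LineData.N,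
    lineData_K, lineData_s, lineData_X2, dotProduct_comm ξ k]
  ring

/-- `freqNormSq` of an integer vector is its dot square. -/
theorem freqNormSq_eq_dotProduct (w : Fin 3 → ℤ) : Torus.freqNormSq w = ((w ⬝ᵥ w : ℤ) : ℝ) := by
  simp [Torus.freqNormSq, dotProduct_fin3, Fin.sum_univ_three, sq]

/-- The squared frequency of a line site: `|k + mξ|² = N_m`. -/
theorem freqNormSq_lineSite (ξ e k : Fin 3 → ℤ) (m : ℤ) :
    Torus.freqNormSq (k + m • ξ) = (((lineData k ξ e).N m : ℤ) : ℝ) := by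
  rw [freqNormSq_eq_dotProduct, lineSite_dot_self ξ e k m]

/-- `(k' − k)·(k' − k) ≤ 2 k·k + 2 k'·k'`. -/
theorem dotProduct_sub_self_le (k k' : Fin 3 → ℤ) :
    (k' - k) ⬝ᵥ (k' - k) ≤ 2 * (k ⬝ᵥ k) + 2 * (k' ⬝ᵥ k') := by
  rw [dotProduct_fin3, dotProduct_fin3, dotProduct_fin3]
  simp only [Pi.sub_apply]
  nlinarith [sq_nonneg (k 0 + k' 0), sq_nonneg (k 1 + k' 1), sq_nonneg (k 2 + k' 2)]

/-- **Injectivity of line sites on small modes**: if `k·k, k'·k' ≤ L²` and `4L² < ξ·ξ`, then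
`k + mξ = k' + m'ξ` forces `m = m'` and `k = k'`. -/
theorem lineSite_inj {ξ k k' : Fin 3 → ℤ} {m m' Lsq : ℤ} (hk : k ⬝ᵥ k ≤ Lsq) (hk' : k' ⬝ᵥ k' ≤ Lsq)
    (hX : 4 * Lsq < ξ ⬝ᵥ ξ) (h : k + m • ξ = k' + m' • ξ) : m = m' ∧ k = k' := by
  have h' : k' = k + m • ξ - m' • ξ := eq_sub_of_add_eq h.symm
  have hdiff : k' - k = (m - m') • ξ := by rw [h', sub_smul]; abel
  by_cases hm : m = m'
  · subst hm
    simp only [sub_self, zero_smul] at hdiff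
    exact ⟨rfl, (sub_eq_zero.1 hdiff).symm⟩
  · exfalso
    have h1 : (k' - k) ⬝ᵥ (k' - k) = (m - m') ^ 2 * (ξ ⬝ᵥ ξ) := by
      rw [hdiff, smul_dotProduct, dotProduct_smul, smul_eq_mul, smul_eq_mul]; ring
    have h2 : 1 ≤ (m - m') ^ 2 := by
      have : m - m' ≠ 0 := sub_ne_zero.2 hm
      nlinarith [Int.one_le_abs this, sq_abs (m - m')]
    have h3 : 0 ≤ ξ ⬝ᵥ ξ := by rw [dotProduct_fin3]; nlinarith [sq_nonneg (ξ 0), sq_nonneg (ξ 1), sq_nonneg (ξ 2)]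
    have h4 := dotProduct_sub_self_le k k'
    nlinarith

/-- A line site of a forced mode is never the origin once `k·k < ξ·ξ` and `m ≠ 0`... in fact for every `m`,
provided `k ≠ 0` when `m = 0`: here the version used, `m` odd. -/
theorem lineSite_ne_zero {ξ k : Fin 3 → ℤ} {m : ℤ} (hk : k ⬝ᵥ k < ξ ⬝ᵥ ξ) (hm : m % 2 = 1) :
    k + m • ξ ≠ 0 := by
  intro h
  have hk' : k = (-m) • ξ := by
    have := congrArg (fun w => w - m • ξ) h
    simp only [add_sub_cancel_right, zero_sub] at this
    rw [this, neg_smul]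
  have h1 : k ⬝ᵥ k = m ^ 2 * (ξ ⬝ᵥ ξ) := by
    rw [hk', smul_dotProduct, dotProduct_smul, smul_eq_mul, smul_eq_mul]; ring
  have h2 : 1 ≤ m ^ 2 := by
    have : m ≠ 0 := by intro h0; simp [h0] at hm
    nlinarith [Int.one_le_abs this, sq_abs m]
  have h3 : 0 ≤ ξ ⬝ᵥ ξ := by rw [dotProduct_fin3]; nlinarith [sq_nonneg (ξ 0), sq_nonneg (ξ 1), sq_nonneg (ξ 2)]
  nlinarith

/-! ### Symmetry `(k, v) ↦ (−k, conj v)` of the line data -/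

/-- `lineData (−k)` negates `a, c, s` and keeps `K, X2, e2, n2`. -/
theorem lineData_neg (k ξ e : Fin 3 → ℤ) :
    lineData (-k) ξ e = ⟨-(lineData k ξ e).a, -(lineData k ξ e).c, -(lineData k ξ e).s, (lineData k ξ e).K,
      (lineData k ξ e).X2, (lineData k ξ e).e2, (lineData k ξ e).n2⟩ := by
  simp [lineData, neg_dotProduct, dotProduct_neg]

/-- `lineForce` of the conjugate vector conjugates the three components. -/
theorem lineForce_conjVec (ξ e : Fin 3 → ℤ) (v : EuclideanSpace ℂ (Fin 3)) :
    lineForce ξ e (EuclideanSpace.conjVec v) =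
      ⟨starRingEnd ℂ (lineForce ξ e v).ve, starRingEnd ℂ (lineForce ξ e v).vx, starRingEnd ℂ (lineForce ξ e v).vn⟩ := by
  simp only [lineForce, ipair_conjVec, map_div₀, map_intCast]

/-! ### The coefficient vector `lineCoeff` against the triad -/

/-- Pairing a line site with the line coefficient: `(k + mξ) · c_m = a x_m + T_m y_m + c z_m`. -/
theorem ipair_lineSite_lineCoeff {ξ e : Fin 3 → ℤ} (h : ξ ⬝ᵥ e = 0) (k : Fin 3 → ℤ)
    (v : EuclideanSpace ℂ (Fin 3)) (J : ℕ) (m : ℤ) :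
    ipair (k + m • ξ) (lineCoeff ξ e k v J m) =
      ((lineData k ξ e).a : ℂ) * xC (lineData k ξ e) (lineForce ξ e v) J m
        + ((lineData k ξ e).T m : ℂ) * yC (lineData k ξ e) (lineForce ξ e v) J m
        + ((lineData k ξ e).c : ℂ) * zC (lineData k ξ e) (lineForce ξ e v) J m := by
  rw [lineCoeff, ipair_add, ipair_add, ipair_smul, ipair_smul, ipair_smul, ipair_freqVec, ipair_freqVec,
    ipair_freqVec, lineSite_dot_e h, lineSite_dot_xi ξ e k m, lineSite_dot_n ξ e k m, lineData_a, lineData_c]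
  ring

/-- Pairing `ξ` with the line coefficient: `ξ · c_m = y_m X2`. -/
theorem ipair_xi_lineCoeff {ξ e : Fin 3 → ℤ} (h : ξ ⬝ᵥ e = 0) (k : Fin 3 → ℤ)
    (v : EuclideanSpace ℂ (Fin 3)) (J : ℕ) (m : ℤ) :
    ipair ξ (lineCoeff ξ e k v J m) = yC (lineData k ξ e) (lineForce ξ e v) J m * ((ξ ⬝ᵥ ξ : ℤ) : ℂ) := by
  rw [lineCoeff, ipair_add, ipair_add, ipair_smul, ipair_smul, ipair_smul, ipair_freqVec, ipair_freqVec,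
    ipair_freqVec, h, dotProduct_comm ξ (cross3 ξ e), cross3_dotProduct_left]
  simp

/-- Pairing `e` with the line coefficient: `e · c_m = x_m e2`. -/
theorem ipair_e_lineCoeff {ξ e : Fin 3 → ℤ} (h : ξ ⬝ᵥ e = 0) (k : Fin 3 → ℤ)
    (v : EuclideanSpace ℂ (Fin 3)) (J : ℕ) (m : ℤ) :
    ipair e (lineCoeff ξ e k v J m) = xC (lineData k ξ e) (lineForce ξ e v) J m * ((e ⬝ᵥ e : ℤ) : ℂ) := by
  rw [lineCoeff, ipair_add, ipair_add, ipair_smul, ipair_smul, ipair_smul, ipair_freqVec, ipair_freqVec,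
    ipair_freqVec, dotProduct_comm e ξ, h, dotProduct_comm e (cross3 ξ e), cross3_dotProduct_right]
  simp

/-- **Conjugate symmetry of the line coefficients** from the symmetry of the scalar sequences: if
`x, y, z` at the data `(−a, −c, −s, K, X2, e2, n2)`, conjugated force and site `m` are the conjugates of `x, y, z` at
site `−m`, then `c^{(−k, conj v)}_{−m} = conj (c^{(k, v)}_m)`. -/
theorem lineCoeff_neg_conjVec {ξ e : Fin 3 → ℤ} (k : Fin 3 → ℤ) (v : EuclideanSpace ℂ (Fin 3)) (J : ℕ)
    (hsym : ∀ m : ℤ,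
      let d := lineData k ξ e
      let F := lineForce ξ e v
      let d' : LineData := ⟨-d.a, -d.c, -d.s, d.K, d.X2, d.e2, d.n2⟩
      let F' : LineForce := ⟨starRingEnd ℂ F.ve, starRingEnd ℂ F.vx, starRingEnd ℂ F.vn⟩
      xC d' F' J m = starRingEnd ℂ (xC d F J (-m)) ∧ yC d' F' J m = starRingEnd ℂ (yC d F J (-m)) ∧
        zC d' F' J m = starRingEnd ℂ (zC d F J (-m)))
    (m : ℤ) :
    lineCoeff ξ e (-k) (EuclideanSpace.conjVec v) J (-m) = EuclideanSpace.conjVec (lineCoeff ξ e k v J m) := by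
  have h := hsym (-m)
  simp only [neg_neg] at h
  obtain ⟨hx, hy, hz⟩ := h
  rw [lineCoeff, lineCoeff, lineData_neg, lineForce_conjVec, hx, hy, hz, EuclideanSpace.conjVec_add,
    EuclideanSpace.conjVec_add, EuclideanSpace.conjVec_smul, EuclideanSpace.conjVec_smul,
    EuclideanSpace.conjVec_smul, Torus.conjVec_freqVec, Torus.conjVec_freqVec, Torus.conjVec_freqVec]

/-- The norm of the line coefficient against the scalar sizes:
`‖c_m‖ ≤ ‖x_m‖√e2 + ‖y_m‖√X2 + ‖z_m‖√n2`. -/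
theorem norm_lineCoeff_le (ξ e k : Fin 3 → ℤ) (v : EuclideanSpace ℂ (Fin 3)) (J : ℕ) (m : ℤ) :
    ‖lineCoeff ξ e k v J m‖ ≤
      ‖xC (lineData k ξ e) (lineForce ξ e v) J m‖ * Real.sqrt ((e ⬝ᵥ e : ℤ) : ℝ)
        + ‖yC (lineData k ξ e) (lineForce ξ e v) J m‖ * Real.sqrt ((ξ ⬝ᵥ ξ : ℤ) : ℝ)
        + ‖zC (lineData k ξ e) (lineForce ξ e v) J m‖ * Real.sqrt ((cross3 ξ e ⬝ᵥ cross3 ξ e : ℤ) : ℝ) := by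
  rw [lineCoeff]
  refine (norm_add₃_le).trans ?_
  rw [norm_smul, norm_smul, norm_smul, norm_freqVec, norm_freqVec, norm_freqVec]

end Summit.AnomalousDissipation.AnomalousDissipation.Theorems.KolmogorovFloor.Response
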